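import Mathlib
import Summits.AtomisticToContinuum.HydrodynamicLimit.Theorems.OneFlightGossipEngineSuperExponentialEnergyTailsDefsB
import Summits.AtomisticToContinuum.HydrodynamicLimit.Theorems.OneFlightGossipEngineSuperExponentialEnergyTailsGevreyInductionPrelim
import Summits.AtomisticToContinuum.HydrodynamicLimit.Theorems.OneFlightGossipEngineSuperExponentialEnergyTailsMaxPrinciple
import HarnessLib

/-!
# The gain sum of the Gevrey induction under the inductive hypothesis
# (stub `stub_gevreyInduction`, line `Sketch`, crux `SuperExponentialEnergyTails`, stmt-AtomisticToContinuum-17701), stage 3/4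

Pure real analysis over `MomentSystem` (support file `…SuperExponentialEnergyTailsDefsB`, §5).  In the inductive
step at order `k` of the Gevrey induction (stage 4, class `X_i = C Aⁱ (i!)^{3/2}` for `i < k`), the Povzner gain
sum `∑_{0<j<k} C(k,j) C_G (1+min(j,k-j))^q (m_{2j+1} m_{2(k-j)} + m_{2j} m_{2(k-j)+1})` is bounded by

* the two TOP terms carrying the order `2k-1` (`top_term_fst_le` for `j = k-1`, `top_term_snd_le` for `j = 1`):
  `≤ k C_G 2^q E² max(1, m_{2k})` each (complementary orders, `moment_mul_moment_le` of stage 2);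
* the LOWER terms (`lower_prod_fst_le`, `lower_prod_snd_le`): `C(k,j) · product ≤ C² Aᵏ √A k^{3/4} (k!)^{3/2}/√C(k,j)`
  through `m_{2i+1} ≤ √(X_i X_{i+1})` (`moment_odd_le_sqrt`, `sqrt_class_mul_class_succ_le`,
  `choose_mul_rpow_factorial` of stages 1–2);

giving `gain_sum_le` / the registered stub `gevreyGainSum`:
`sum ≤ 2 k C_G 2^q E² max(1,y) + 2 C_G Q ∑_{0<j<k} (1+min(j,k-j))^q/√C(k,j)`, `Q = C² Aᵏ √A k^{3/4} (k!)^{3/2}`.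

prover-line-stmt-AtomisticToContinuum-17701-0 (stub worker `stub_gevreyInduction`).
-/

noncomputable section

namespace Summit.AtomisticToContinuum.HydrodynamicLimit.Theorems.SuperExponentialEnergyTailsGevreyGain

open scoped BigOperators
open MeasureTheory Set
open Summit.AtomisticToContinuum.HydrodynamicLimit.Theorems.SuperExponentialEnergyTailsLine (MomentSystem)
open Summit.AtomisticToContinuum.HydrodynamicLimit.Theorems.SuperExponentialEnergyTailsGevreyInductionPrelim
  (choose_mul_rpow_factorial sqrt_class_mul_class_succ_le min_cast_nonneg)
open Summit.AtomisticToContinuum.HydrodynamicLimit.Theorems.SuperExponentialEnergyTailsMaxPrinciple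
  (moment_mul_moment_le moment_odd_le_sqrt)

variable {t ν : ℝ} {n k₁ q : ℕ} {K₁ K₂ CG CSD E₁ C₀ A₀ : ℝ} {m : ℕ → ℝ → ℝ}

/-! ## §1 Lower and top gain terms -/

/-- **Lower gain products, first kind.**  Under the inductive class `m_{2i} ≤ X_i = C Aⁱ (i!)^{3/2}` for `i < k`,
for `1 ≤ j`, `j + 1 < k`: `C(k,j) · m_{2j+1} m_{2(k-j)} ≤ C² Aᵏ √A k^{3/4} · (k!)^{3/2}/√C(k,j)`
(`m_{2j+1} ≤ √(X_j X_{j+1})`, `sqrt_class_mul_class_succ_le`, `choose_mul_rpow_factorial`). [folklore] -/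
theorem lower_prod_fst_le (hM : MomentSystem t ν n k₁ q K₁ K₂ CG CSD E₁ C₀ A₀ m) {C A : ℝ} (hC : 0 ≤ C)
    (hA : 0 ≤ A) {k : ℕ}
    (IH : ∀ i < k, ∀ s ∈ Set.Icc 0 t, m (2 * i) s ≤ C * A ^ i * (i.factorial : ℝ) ^ ((3 : ℝ) / 2))
    {j : ℕ} (hj1 : 1 ≤ j) (hjk : j + 1 < k) {r : ℝ} (hr : r ∈ Set.Icc 0 t) :
    (k.choose j : ℝ) * (m (2 * j + 1) r * m (2 * (k - j)) r)
      ≤ C ^ 2 * A ^ k * Real.sqrt A * (k : ℝ) ^ ((3 : ℝ) / 4) *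
          ((k.factorial : ℝ) ^ ((3 : ℝ) / 2) / Real.sqrt (k.choose j)) := by
  have hodd : m (2 * j + 1) r
      ≤ C * A ^ j * Real.sqrt A * (j.factorial : ℝ) ^ ((3 : ℝ) / 2) * (k : ℝ) ^ ((3 : ℝ) / 4) := by
    calc m (2 * j + 1) r ≤ Real.sqrt (m (2 * j) r * m (2 * j + 2) r) := moment_odd_le_sqrt hM j hr
      _ ≤ Real.sqrt ((C * A ^ j * (j.factorial : ℝ) ^ ((3 : ℝ) / 2)) *
            (C * A ^ (j + 1) * ((j + 1).factorial : ℝ) ^ ((3 : ℝ) / 2))) := by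
          apply Real.sqrt_le_sqrt
          have h1 := IH j (by omega) r hr
          have h2 := IH (j + 1) hjk r hr
          rw [show 2 * (j + 1) = 2 * j + 2 by ring] at h2
          exact mul_le_mul h1 h2 (hM.nonneg _ r hr) (by positivity)
      _ ≤ _ := sqrt_class_mul_class_succ_le hC hA hjk.le
  have heven : m (2 * (k - j)) r ≤ C * A ^ (k - j) * ((k - j).factorial : ℝ) ^ ((3 : ℝ) / 2) :=
    IH (k - j) (by omega) r hr
  have hAk : A ^ j * A ^ (k - j) = A ^ k := by
    rw [← pow_add, Nat.add_sub_cancel' (by omega : j ≤ k)]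
  have hcomb := choose_mul_rpow_factorial (show j ≤ k by omega)
  calc (k.choose j : ℝ) * (m (2 * j + 1) r * m (2 * (k - j)) r)
        ≤ (k.choose j : ℝ) * ((C * A ^ j * Real.sqrt A * (j.factorial : ℝ) ^ ((3 : ℝ) / 2) *
            (k : ℝ) ^ ((3 : ℝ) / 4)) * (C * A ^ (k - j) * ((k - j).factorial : ℝ) ^ ((3 : ℝ) / 2))) :=
          mul_le_mul_of_nonneg_left (mul_le_mul hodd heven (hM.nonneg _ r hr) (by positivity))
            (Nat.cast_nonneg _)
    _ = C ^ 2 * (A ^ j * A ^ (k - j)) * Real.sqrt A * (k : ℝ) ^ ((3 : ℝ) / 4) *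
          ((k.choose j : ℝ) * ((j.factorial : ℝ) ^ ((3 : ℝ) / 2) * ((k - j).factorial : ℝ) ^ ((3 : ℝ) / 2))) := by
          ring
    _ = _ := by rw [hAk, hcomb]

/-- **Lower gain products, second kind.**  Under the inductive class, for `2 ≤ j < k`:
`C(k,j) · m_{2j} m_{2(k-j)+1} ≤ C² Aᵏ √A k^{3/4} · (k!)^{3/2}/√C(k,j)`. [folklore] -/
theorem lower_prod_snd_le (hM : MomentSystem t ν n k₁ q K₁ K₂ CG CSD E₁ C₀ A₀ m) {C A : ℝ} (hC : 0 ≤ C)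
    (hA : 0 ≤ A) {k : ℕ}
    (IH : ∀ i < k, ∀ s ∈ Set.Icc 0 t, m (2 * i) s ≤ C * A ^ i * (i.factorial : ℝ) ^ ((3 : ℝ) / 2))
    {j : ℕ} (hj2 : 2 ≤ j) (hjk : j < k) {r : ℝ} (hr : r ∈ Set.Icc 0 t) :
    (k.choose j : ℝ) * (m (2 * j) r * m (2 * (k - j) + 1) r)
      ≤ C ^ 2 * A ^ k * Real.sqrt A * (k : ℝ) ^ ((3 : ℝ) / 4) *
          ((k.factorial : ℝ) ^ ((3 : ℝ) / 2) / Real.sqrt (k.choose j)) := by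
  have heven : m (2 * j) r ≤ C * A ^ j * (j.factorial : ℝ) ^ ((3 : ℝ) / 2) := IH j hjk r hr
  have hodd : m (2 * (k - j) + 1) r
      ≤ C * A ^ (k - j) * Real.sqrt A * ((k - j).factorial : ℝ) ^ ((3 : ℝ) / 2) * (k : ℝ) ^ ((3 : ℝ) / 4) := by
    calc m (2 * (k - j) + 1) r ≤ Real.sqrt (m (2 * (k - j)) r * m (2 * (k - j) + 2) r) :=
          moment_odd_le_sqrt hM (k - j) hr
      _ ≤ Real.sqrt ((C * A ^ (k - j) * ((k - j).factorial : ℝ) ^ ((3 : ℝ) / 2)) *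
            (C * A ^ (k - j + 1) * ((k - j + 1).factorial : ℝ) ^ ((3 : ℝ) / 2))) := by
          apply Real.sqrt_le_sqrt
          have h1 := IH (k - j) (by omega) r hr
          have h2 := IH (k - j + 1) (by omega) r hr
          rw [show 2 * (k - j + 1) = 2 * (k - j) + 2 by ring] at h2
          exact mul_le_mul h1 h2 (hM.nonneg _ r hr) (by positivity)
      _ ≤ _ := sqrt_class_mul_class_succ_le hC hA (by omega : k - j + 1 ≤ k)
  have hAk : A ^ j * A ^ (k - j) = A ^ k := by
    rw [← pow_add, Nat.add_sub_cancel' hjk.le]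
  have hcomb := choose_mul_rpow_factorial hjk.le
  calc (k.choose j : ℝ) * (m (2 * j) r * m (2 * (k - j) + 1) r)
        ≤ (k.choose j : ℝ) * ((C * A ^ j * (j.factorial : ℝ) ^ ((3 : ℝ) / 2)) *
            (C * A ^ (k - j) * Real.sqrt A * ((k - j).factorial : ℝ) ^ ((3 : ℝ) / 2) *
              (k : ℝ) ^ ((3 : ℝ) / 4))) :=
          mul_le_mul_of_nonneg_left (mul_le_mul heven hodd (hM.nonneg _ r hr) (by positivity))
            (Nat.cast_nonneg _)
    _ = C ^ 2 * (A ^ j * A ^ (k - j)) * Real.sqrt A * (k : ℝ) ^ ((3 : ℝ) / 4) *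
          ((k.choose j : ℝ) * ((j.factorial : ℝ) ^ ((3 : ℝ) / 2) * ((k - j).factorial : ℝ) ^ ((3 : ℝ) / 2))) := by
          ring
    _ = _ := by rw [hAk, hcomb]

/-- **Top gain term, first kind** (`j = k - 1`, carrying `m_{2k-1} m_2`): at most `k C_G 2^q E² max(1, m_{2k})`
(`C(k,k-1) = k`, `min(k-1, 1) ≤ 1`, complementary orders `moment_mul_moment_le`). [folklore] -/
theorem top_term_fst_le (hM : MomentSystem t ν n k₁ q K₁ K₂ CG CSD E₁ C₀ A₀ m) (hCG : 0 ≤ CG) {k j : ℕ}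
    (hk : 2 ≤ k) (hj : j + 1 = k) {r : ℝ} (hr : r ∈ Set.Icc 0 t) :
    (k.choose j : ℝ) * (CG * (1 + (min j (k - j) : ℝ)) ^ q) * (m (2 * j + 1) r * m (2 * (k - j)) r)
      ≤ (k : ℝ) * CG * 2 ^ q * (max E₁ 1 ^ 2 * max 1 (m (2 * k) r)) := by
  have hc : (k.choose j : ℝ) = k := by
    have h : k.choose j = k := by
      rw [← hj]
      exact Nat.choose_succ_self_right j
    exact_mod_cast h
  have hkj : (k : ℝ) - j = 1 := by
    have : (k : ℝ) = j + 1 := by exact_mod_cast hj.symm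
    linarith
  have hmin0 : 0 ≤ min (j : ℝ) ((k : ℝ) - j) := min_cast_nonneg (by omega)
  have hmin1 : 1 + min (j : ℝ) ((k : ℝ) - j) ≤ 2 := by
    have := min_le_right (j : ℝ) ((k : ℝ) - j)
    linarith
  have hxq : (1 + min (j : ℝ) ((k : ℝ) - j)) ^ q ≤ 2 ^ q := pow_le_pow_left₀ (by linarith) hmin1 q
  have hP : m (2 * j + 1) r * m (2 * (k - j)) r ≤ max E₁ 1 ^ 2 * max 1 (m (2 * k) r) :=
    moment_mul_moment_le hM hk (by omega) (by omega) (by omega) hr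
  have hPnn : 0 ≤ m (2 * j + 1) r * m (2 * (k - j)) r := mul_nonneg (hM.nonneg _ r hr) (hM.nonneg _ r hr)
  rw [hc]
  calc (k : ℝ) * (CG * (1 + min (j : ℝ) ((k : ℝ) - j)) ^ q) * (m (2 * j + 1) r * m (2 * (k - j)) r)
        ≤ (k : ℝ) * (CG * 2 ^ q) * (max E₁ 1 ^ 2 * max 1 (m (2 * k) r)) :=
          mul_le_mul (mul_le_mul_of_nonneg_left (mul_le_mul_of_nonneg_left hxq hCG) (Nat.cast_nonneg k))
            hP hPnn (by positivity)
    _ = _ := by ring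

/-- **Top gain term, second kind** (`j = 1`, carrying `m_2 m_{2k-1}`): at most `k C_G 2^q E² max(1, m_{2k})`.
[folklore] -/
theorem top_term_snd_le (hM : MomentSystem t ν n k₁ q K₁ K₂ CG CSD E₁ C₀ A₀ m) (hCG : 0 ≤ CG) {k j : ℕ}
    (hk : 2 ≤ k) (hj : j = 1) {r : ℝ} (hr : r ∈ Set.Icc 0 t) :
    (k.choose j : ℝ) * (CG * (1 + (min j (k - j) : ℝ)) ^ q) * (m (2 * j) r * m (2 * (k - j) + 1) r)
      ≤ (k : ℝ) * CG * 2 ^ q * (max E₁ 1 ^ 2 * max 1 (m (2 * k) r)) := by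
  subst hj
  have hc : (k.choose 1 : ℝ) = k := by
    exact_mod_cast Nat.choose_one_right k
  have hmin0 : 0 ≤ min ((1 : ℕ) : ℝ) ((k : ℝ) - (1 : ℕ)) := min_cast_nonneg (by omega)
  have hmin1 : 1 + min ((1 : ℕ) : ℝ) ((k : ℝ) - (1 : ℕ)) ≤ 2 := by
    have := min_le_left ((1 : ℕ) : ℝ) ((k : ℝ) - (1 : ℕ))
    push_cast at this ⊢
    linarith
  have hxq : (1 + min ((1 : ℕ) : ℝ) ((k : ℝ) - (1 : ℕ))) ^ q ≤ 2 ^ q := pow_le_pow_left₀ (by linarith) hmin1 q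
  have hP : m (2 * 1) r * m (2 * (k - 1) + 1) r ≤ max E₁ 1 ^ 2 * max 1 (m (2 * k) r) :=
    moment_mul_moment_le hM hk (by omega) (by omega) (by omega) hr
  have hPnn : 0 ≤ m (2 * 1) r * m (2 * (k - 1) + 1) r := mul_nonneg (hM.nonneg _ r hr) (hM.nonneg _ r hr)
  rw [hc]
  calc (k : ℝ) * (CG * (1 + min ((1 : ℕ) : ℝ) ((k : ℝ) - (1 : ℕ))) ^ q) * (m (2 * 1) r * m (2 * (k - 1) + 1) r)
        ≤ (k : ℝ) * (CG * 2 ^ q) * (max E₁ 1 ^ 2 * max 1 (m (2 * k) r)) :=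
          mul_le_mul (mul_le_mul_of_nonneg_left (mul_le_mul_of_nonneg_left hxq hCG) (Nat.cast_nonneg k))
            hP hPnn (by positivity)
    _ = _ := by ring

/-- **The gain sum under the inductive hypothesis.**  For `k ≥ 2` and the class `X_i = C Aⁱ (i!)^{3/2}` below `k`:
`∑_{0<j<k} C(k,j) c_j (m_{2j+1} m_{2(k-j)} + m_{2j} m_{2(k-j)+1}) ≤ 2 k C_G 2^q E² max(1,y) + 2 C_G Q ∑_{0<j<k} w_j`
with `Q = C² Aᵏ √A k^{3/4} (k!)^{3/2}`, `w_j = (1 + min(j,k-j))^q/√C(k,j)`: split off the top terms `j = k-1`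
(first products) and `j = 1` (second products), bound the rest by `lower_prod_fst_le` / `lower_prod_snd_le`. [folklore] -/
theorem gain_sum_le (hM : MomentSystem t ν n k₁ q K₁ K₂ CG CSD E₁ C₀ A₀ m) (hCG : 0 ≤ CG) {C A : ℝ}
    (hC : 0 ≤ C) (hA : 0 ≤ A) {k : ℕ} (hk : 2 ≤ k)
    (IH : ∀ i < k, ∀ s ∈ Set.Icc 0 t, m (2 * i) s ≤ C * A ^ i * (i.factorial : ℝ) ^ ((3 : ℝ) / 2))
    {r : ℝ} (hr : r ∈ Set.Icc 0 t) :
    ∑ j ∈ Finset.Ioo 0 k, (k.choose j : ℝ) * (CG * (1 + (min j (k - j) : ℝ)) ^ q) *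
        (m (2 * j + 1) r * m (2 * (k - j)) r + m (2 * j) r * m (2 * (k - j) + 1) r)
      ≤ 2 * ((k : ℝ) * CG * 2 ^ q * (max E₁ 1 ^ 2 * max 1 (m (2 * k) r)))
        + 2 * (CG * (C ^ 2 * A ^ k * Real.sqrt A * (k : ℝ) ^ ((3 : ℝ) / 4) * (k.factorial : ℝ) ^ ((3 : ℝ) / 2)) *
            ∑ j ∈ Finset.Ioo 0 k, (1 + (min j (k - j) : ℝ)) ^ q / Real.sqrt (k.choose j)) := by
  set Q : ℝ := C ^ 2 * A ^ k * Real.sqrt A * (k : ℝ) ^ ((3 : ℝ) / 4) * (k.factorial : ℝ) ^ ((3 : ℝ) / 2)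
    with hQ
  set T : ℝ := (k : ℝ) * CG * 2 ^ q * (max E₁ 1 ^ 2 * max 1 (m (2 * k) r)) with hT
  have hQ0 : 0 ≤ Q := by positivity
  have hmemk : k - 1 ∈ Finset.Ioo 0 k := by
    rw [Finset.mem_Ioo]
    omega
  have hmem1 : 1 ∈ Finset.Ioo 0 k := by
    rw [Finset.mem_Ioo]
    omega
  have hw0 : ∀ j ∈ Finset.Ioo 0 k, 0 ≤ (1 + (min j (k - j) : ℝ)) ^ q / Real.sqrt (k.choose j) := by
    intro j hj
    rw [Finset.mem_Ioo] at hj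
    have := min_cast_nonneg hj.2.le
    positivity
  -- split the two kinds of products
  have hsplit : ∑ j ∈ Finset.Ioo 0 k, (k.choose j : ℝ) * (CG * (1 + (min j (k - j) : ℝ)) ^ q) *
        (m (2 * j + 1) r * m (2 * (k - j)) r + m (2 * j) r * m (2 * (k - j) + 1) r)
      = ∑ j ∈ Finset.Ioo 0 k, (k.choose j : ℝ) * (CG * (1 + (min j (k - j) : ℝ)) ^ q) *
          (m (2 * j + 1) r * m (2 * (k - j)) r)
        + ∑ j ∈ Finset.Ioo 0 k, (k.choose j : ℝ) * (CG * (1 + (min j (k - j) : ℝ)) ^ q) *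
          (m (2 * j) r * m (2 * (k - j) + 1) r) := by
    rw [← Finset.sum_add_distrib]
    refine Finset.sum_congr rfl fun j _ => by ring
  -- lower terms of the first kind
  have hlow1 : ∀ j ∈ (Finset.Ioo 0 k).erase (k - 1),
      (k.choose j : ℝ) * (CG * (1 + (min j (k - j) : ℝ)) ^ q) * (m (2 * j + 1) r * m (2 * (k - j)) r)
        ≤ CG * Q * ((1 + (min j (k - j) : ℝ)) ^ q / Real.sqrt (k.choose j)) := by
    intro j hj
    obtain ⟨hne, hj'⟩ := Finset.mem_erase.mp hj
    rw [Finset.mem_Ioo] at hj'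
    have hb := lower_prod_fst_le hM hC hA IH (j := j) (by omega) (by omega) hr
    have hmin := min_cast_nonneg (show j ≤ k by omega)
    calc (k.choose j : ℝ) * (CG * (1 + (min j (k - j) : ℝ)) ^ q) * (m (2 * j + 1) r * m (2 * (k - j)) r)
          = CG * (1 + (min j (k - j) : ℝ)) ^ q * ((k.choose j : ℝ) * (m (2 * j + 1) r * m (2 * (k - j)) r)) := by
            ring
      _ ≤ CG * (1 + (min j (k - j) : ℝ)) ^ q * (C ^ 2 * A ^ k * Real.sqrt A * (k : ℝ) ^ ((3 : ℝ) / 4) *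
            ((k.factorial : ℝ) ^ ((3 : ℝ) / 2) / Real.sqrt (k.choose j))) := by
            gcongr
      _ = CG * Q * ((1 + (min j (k - j) : ℝ)) ^ q / Real.sqrt (k.choose j)) := by
            rw [hQ]
            ring
  -- lower terms of the second kind
  have hlow2 : ∀ j ∈ (Finset.Ioo 0 k).erase 1,
      (k.choose j : ℝ) * (CG * (1 + (min j (k - j) : ℝ)) ^ q) * (m (2 * j) r * m (2 * (k - j) + 1) r)
        ≤ CG * Q * ((1 + (min j (k - j) : ℝ)) ^ q / Real.sqrt (k.choose j)) := by
    intro j hj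
    obtain ⟨hne, hj'⟩ := Finset.mem_erase.mp hj
    rw [Finset.mem_Ioo] at hj'
    have hb := lower_prod_snd_le hM hC hA IH (j := j) (by omega) (by omega) hr
    have hmin := min_cast_nonneg (show j ≤ k by omega)
    calc (k.choose j : ℝ) * (CG * (1 + (min j (k - j) : ℝ)) ^ q) * (m (2 * j) r * m (2 * (k - j) + 1) r)
          = CG * (1 + (min j (k - j) : ℝ)) ^ q * ((k.choose j : ℝ) * (m (2 * j) r * m (2 * (k - j) + 1) r)) := by
            ring
      _ ≤ CG * (1 + (min j (k - j) : ℝ)) ^ q * (C ^ 2 * A ^ k * Real.sqrt A * (k : ℝ) ^ ((3 : ℝ) / 4) *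
            ((k.factorial : ℝ) ^ ((3 : ℝ) / 2) / Real.sqrt (k.choose j))) := by
            gcongr
      _ = CG * Q * ((1 + (min j (k - j) : ℝ)) ^ q / Real.sqrt (k.choose j)) := by
            rw [hQ]
            ring
  -- the erased sums are at most CG Q ∑ w
  have hrest : ∀ i : ℕ, ∑ j ∈ (Finset.Ioo 0 k).erase i, CG * Q * ((1 + (min j (k - j) : ℝ)) ^ q / Real.sqrt (k.choose j))
      ≤ CG * Q * ∑ j ∈ Finset.Ioo 0 k, (1 + (min j (k - j) : ℝ)) ^ q / Real.sqrt (k.choose j) := by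
    intro i
    rw [Finset.mul_sum]
    refine Finset.sum_le_sum_of_subset_of_nonneg (Finset.erase_subset _ _) fun j hj _ => ?_
    exact mul_nonneg (mul_nonneg hCG hQ0) (hw0 j hj)
  have h1 : ∑ j ∈ Finset.Ioo 0 k, (k.choose j : ℝ) * (CG * (1 + (min j (k - j) : ℝ)) ^ q) *
        (m (2 * j + 1) r * m (2 * (k - j)) r)
      ≤ T + CG * Q * ∑ j ∈ Finset.Ioo 0 k, (1 + (min j (k - j) : ℝ)) ^ q / Real.sqrt (k.choose j) := by
    rw [← Finset.add_sum_erase _ _ hmemk]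
    refine add_le_add (top_term_fst_le hM hCG hk (by omega) hr) ?_
    exact (Finset.sum_le_sum hlow1).trans (hrest _)
  have h2 : ∑ j ∈ Finset.Ioo 0 k, (k.choose j : ℝ) * (CG * (1 + (min j (k - j) : ℝ)) ^ q) *
        (m (2 * j) r * m (2 * (k - j) + 1) r)
      ≤ T + CG * Q * ∑ j ∈ Finset.Ioo 0 k, (1 + (min j (k - j) : ℝ)) ^ q / Real.sqrt (k.choose j) := by
    rw [← Finset.add_sum_erase _ _ hmem1]
    refine add_le_add (top_term_snd_le hM hCG hk rfl hr) ?_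
    exact (Finset.sum_le_sum hlow2).trans (hrest _)
  rw [hsplit]
  linarith

/-! ## §2 Registered form -/

/-- **The gain sum under the inductive hypothesis** — registered stub `gevreyGainSum` of this support file (the
explicit-binder form of `gain_sum_le`). [folklore] -/
theorem gevreyGainSum : ∀ (t ν : ℝ) (n k₁ q : ℕ) (K₁ K₂ CG CSD E₁ C₀ A₀ : ℝ) (m : ℕ → ℝ → ℝ), Summit.AtomisticToContinuum.HydrodynamicLimit.Theorems.SuperExponentialEnergyTailsLine.MomentSystem t ν n k₁ q K₁ K₂ CG CSD E₁ C₀ A₀ m → 0 ≤ CG → ∀ (C A : ℝ), 0 ≤ C → 0 ≤ A → ∀ (k : ℕ), 2 ≤ k → (∀ i < k, ∀ s ∈ Set.Icc 0 t, m (2 * i) s ≤ C * A ^ i * (i.factorial : ℝ) ^ ((3 : ℝ) / 2)) → ∀ r ∈ Set.Icc 0 t, ∑ j ∈ Finset.Ioo 0 k, (k.choose j : ℝ) * (CG * (1 + (min j (k - j) : ℝ)) ^ q) * (m (2 * j + 1) r * m (2 * (k - j)) r + m (2 * j) r * m (2 * (k - j) + 1) r) ≤ 2 * ((k : ℝ)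 * CG * 2 ^ q * (max E₁ 1 ^ 2 * max 1 (m (2 * k) r))) + 2 * (CG * (C ^ 2 * A ^ k * Real.sqrt A * (k : ℝ) ^ ((3 : ℝ) / 4) * (k.factorial : ℝ) ^ ((3 : ℝ) / 2)) * ∑ j ∈ Finset.Ioo 0 k, (1 + (min j (k - j) : ℝ)) ^ q / Real.sqrt (k.choose j)) := by
  intro t ν n k₁ q K₁ K₂ CG CSD E₁ C₀ A₀ m hM hCG C A hC hA k hk IH r hr
  exact gain_sum_le hM hCG hC hA hk IH hr

end Summit.AtomisticToContinuum.HydrodynamicLimit.Theorems.SuperExponentialEnergyTailsGevreyGain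

end
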